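import Summits.NavierStokesRegularity.NavierStokesRegularity.Theorems.TerminalTraceTypeITraceScarL3LogMeanApexEngine
import Summits.NavierStokesRegularity.NavierStokesRegularity.Theorems.TerminalTraceTypeITraceScarL3SqrtTwoApexReprSliceBounds
import Summits.NavierStokesRegularity.NavierStokesRegularity.Theorems.TerminalTraceTypeITraceScarL3SqrtTwoApexShellPressureMild
import Literature.Analysis.FluidPDE.TypeIRateClassicalRepresentative
import Mathlib.Topology.Order.Compact
import HarnessLib

/-!
# T28-B from an ALMOST-EVERYWHERE rate with log-mean `q` (ROUND-28 §3; T28-C storey (B1)): the package-level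
# log-mean threshold WITHOUT continuity or measurability of the rate
# (item `TerminalTrace.TypeITraceScarL3`, stmt-NavierStokesRegularity-18385, Stub LOUD line; helper)

Seat nsreg-C26-p1 g2 (cell ns-regularity-ideate), `--supports stmt-NavierStokesRegularity-18385` (helper);
planner-of-record nsreg-p2 g29 (ROUND-28 §3 T28-B/C; DIRECTOR-NS #130 (2)).

This is the form in which the zoom of a blow-up delivers the log-mean hypothesis (reverse Fatou along the
zooms gives an a.e. bound by `β_∞ = limsup_j β_j`, a function with no regularity): the extinct Type-I apex
package of class `(M, D₀, C)` (ANY `C`), backward singular at the origin, QUIET on a shell slab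
`]−δ,0[ × {R < |y| < AR}`, with
  (a.e. rate)   `‖U(s, y)‖ ≤ β(s)` for a.e. `(s, y) ∈ ]T,0[ × ℝ³`,
  (LM_q)        `∫⁻_{]s',s[} β² ≤ 2q·log((−s')/(−s)) + K₀` for `T < s' ≤ s < 0` (a `lintegral`: NOTHING is
                asked of `β` — not continuity, not measurability, not integrability),
has `1 ≤ q` — **`one_le_logMean_of_quietShell_of_aeRate`**.

Proof.  WLOG `q ≥ 0` (replace `q` by `max q 0`).  Take the classical Oseen-mild representative `V`
(`exists_classical_repr_of_apexPackage`, which runs on the constant `C`) and MANUFACTURE a continuous rate: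
`β_loc(s) := sup_{|y| ≤ AR} ‖V(s, y)‖` is continuous on `]−∞,0[` (`IsCompact.continuous_sSup`, `V` jointly
continuous), bounds `V` on the ball `{|y| < AR}` containing the shell, and `β_loc ≤ β` for a.e. `s` (Fubini +
continuity of `V(s, ·)`: an open null set is empty), so `∫_{s'}^{s} β_loc² ≤ 2q log + K₀`; with
`P(s) := ∫^{s} β_loc²/2` (FTC at every point, `β_loc` continuous), `p := (−s)β_loc²/2`, the LOCAL-RATE engine
`one_le_logMean_of_quietShell_of_reprBudget_ball` (window shell budgets exactly as in T27-A/T28-B: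
`exists_shellBudget_of_mild`, `lintegral_ball_repr_sq_le`, `norm_repr_le_of_quietShell`) gives `1 ≤ q`.

WHAT THIS IS NOT: not the zoom (storey (B2) of T28-C), not Stub LOUD, NOT a proof of Navier–Stokes regularity.
[folklore; Ghidaglia 1986; Agmon–Nirenberg 1967; Temam IDDS 1997 §III.6; Seregin2014 Prop. 6.20;
CaffarelliKohnNirenberg1982 Thm B; KochNadirashviliSereginSverak2009 §4]
-/

noncomputable section

set_option linter.dupNamespace false

namespace Summit.NavierStokesRegularity.NavierStokesRegularity.Theorems.TypeITraceScarL3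

open MeasureTheory Set Function Filter Topology Metric InnerProductSpace
open Literature.Analysis Literature.Analysis.FluidPDE Literature.Analysis.UnboundedOperators
open scoped NNReal ENNReal RealInnerProductSpace ContDiff

/-- An a.e. bound for a continuous real function on `ℝ³` holds everywhere (an open null set is empty). -/
theorem forall_le_of_ae_le_of_continuous {g : EuclideanSpace ℝ (Fin 3) → ℝ} {c : ℝ} (hg : Continuous g)
    (h : ∀ᵐ y : EuclideanSpace ℝ (Fin 3), g y ≤ c) : ∀ y, g y ≤ c := by
  intro y
  by_contra hlt
  rw [not_le] at hlt
  have hopen : IsOpen (g ⁻¹' Ioi c) := isOpen_Ioi.preimage hg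
  have hpos : 0 < volume (g ⁻¹' Ioi c) := hopen.measure_pos volume ⟨y, hlt⟩
  have hzero : volume (g ⁻¹' Ioi c) = 0 := by
    refine measure_mono_null (fun z hz => ?_) (ae_iff.1 h)
    exact not_le.2 (mem_preimage.1 hz)
  exact absurd hzero hpos.ne'

/-- **T28-B's threshold from an a.e. rate with log-mean `q` (module docstring): `1 ≤ q`.**
[folklore; Ghidaglia 1986; Agmon–Nirenberg 1967; Temam IDDS 1997 §III.6; Seregin2014 Prop. 6.20] -/
theorem one_le_logMean_of_quietShell_of_aeRate :
    ∀ (M D₀ : ℝ≥0) (C : ℝ)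
      (U : ℝ → EuclideanSpace ℝ (Fin 3) → EuclideanSpace ℝ (Fin 3))
      (P : ℝ → EuclideanSpace ℝ (Fin 3) → ℝ)
      (G : ℝ → EuclideanSpace ℝ (Fin 3) →
        EuclideanSpace ℝ (Fin 3) →L[ℝ] EuclideanSpace ℝ (Fin 3)),
      (∀ a : ℝ, 0 < a →
        IsSuitableWeakSolutionInBall a (0 : ℝ × EuclideanSpace ℝ (Fin 3)) U P) →
      (∀ a : ℝ, 0 < a →
        HasWeakSpatialGradientOn
          (parabolicCylinderOpens a (0 : ℝ × EuclideanSpace ℝ (Fin 3))) U G) →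
      (∀ a : ℝ, 0 < a →
        typeIBound (parabolicCylinder a (0 : ℝ × EuclideanSpace ℝ (Fin 3))) U P G ≤ M) →
      (∀ z₀ : ℝ × EuclideanSpace ℝ (Fin 3), z₀.1 ≤ 0 →
        ∀ r : ℝ, 0 < r → cknD r z₀ P ≤ D₀) →
      (∀ s : ℝ, s < 0 →
        ∀ᵐ y : EuclideanSpace ℝ (Fin 3), ‖U s y‖ ≤ C / Real.sqrt (-s)) →
      (∀ φ : EuclideanSpace ℝ (Fin 3) → EuclideanSpace ℝ (Fin 3),
        ContDiff ℝ (⊤ : ℕ∞) φ →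
        HasCompactSupport φ → ∀ ε : ℝ, 0 < ε →
        ∃ s₀ : ℝ, s₀ < 0 ∧ ∀ᵐ s ∂(volume.restrict (Ioo s₀ 0)), |∫ y, ⟪U s y, φ y⟫| ≤ ε) →
      IsBackwardSingularPoint U (0 : ℝ × EuclideanSpace ℝ (Fin 3)) →
      ∀ (A R δ K : ℝ), 1 < A → 0 < R → 0 < δ →
        (∀ᵐ z ∂(volume.restrict
          (Ioo (-δ) 0 ×ˢ {y : EuclideanSpace ℝ (Fin 3) | R < ‖y‖ ∧ ‖y‖ < A * R})),
            ‖U z.1 z.2‖ ≤ K) →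
      ∀ (T : ℝ) (β : ℝ → ℝ) (q K₀ : ℝ), T < 0 → 0 ≤ K₀ →
        (∀ᵐ z ∂(volume.restrict (Ioo T 0 ×ˢ (univ : Set (EuclideanSpace ℝ (Fin 3))))),
          ‖U z.1 z.2‖ ≤ β z.1) →
        (∀ s' ∈ Ioo T 0, ∀ s ∈ Ioo T 0, s' ≤ s →
          ∫⁻ σ in Ioo s' s, ENNReal.ofReal (β σ ^ 2) ≤
            ENNReal.ofReal (2 * q * Real.log ((-s') / (-s)) + K₀)) →
        1 ≤ q := by
  intro M D₀ C U P G hsw hG hI hD hrate htop hsing A R δ K hA hR hδ hq T β q K₀ hT hK₀ hβU hLM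
  -- ### WLOG `q ≥ 0`
  suffices h : 1 ≤ max q 0 by
    rcases le_max_iff.1 h with h | h
    · exact h
    · linarith
  have hLM' : ∀ s' ∈ Ioo T 0, ∀ s ∈ Ioo T 0, s' ≤ s →
      ∫⁻ σ in Ioo s' s, ENNReal.ofReal (β σ ^ 2) ≤
        ENNReal.ofReal (2 * max q 0 * Real.log ((-s') / (-s)) + K₀) := by
    intro s' hs' s hs h
    refine (hLM s' hs' s hs h).trans (ENNReal.ofReal_le_ofReal ?_)
    have hlog : 0 ≤ Real.log ((-s') / (-s)) :=
      Real.log_nonneg ((one_le_div (by linarith [hs.2])).2 (by linarith))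
    nlinarith [le_max_left q 0, hlog]
  generalize hq'def : max q 0 = q' at hLM' ⊢
  have hq' : 0 ≤ q' := by rw [← hq'def]; exact le_max_right _ _
  -- ### the classical Oseen-mild representative below the top
  obtain ⟨V, hUV, hVc, hdec, hsm, -, hmild, hwin, -⟩ := exists_classical_repr_of_apexPackage hsw hI hrate
  have hUVs := ae_slice_eq_of_ae_eq_slab hUV
  have hC0 : 0 ≤ C := by
    have h := hdec (-1) (by norm_num) 0
    rw [neg_neg, Real.sqrt_one, div_one] at h
    exact (norm_nonneg _).trans h
  have hAR : R < A * R := by nlinarith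
  have hr : 0 < A * R := by positivity
  have h2r : 0 < 2 * (A * R) := by positivity
  -- ### the shell-budget constants at scale `r = A R`
  obtain ⟨Cb, Fb, hCb, hFb, hbud⟩ := exists_shellBudget_of_mild hr
  have hvolT : volume {z : EuclideanSpace ℝ (Fin 3) | R < ‖z‖ ∧ ‖z‖ < A * R} ≠ ⊤ := by
    refine ne_top_of_le_ne_top (measure_ball_lt_top (μ := volume) (x := (0 : EuclideanSpace ℝ (Fin 3)))
      (r := A * R)).ne (measure_mono fun z hz => ?_)
    rw [mem_ball_zero_iff]; exact hz.2
  -- the uniform bound `B₀`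
  obtain ⟨B₀, hB₀def⟩ : ∃ B₀ : ℝ≥0∞, B₀ =
      Cb * ENNReal.ofReal K ^ 2 * volume {z : EuclideanSpace ℝ (Fin 3) | R < ‖z‖ ∧ ‖z‖ < A * R} +
        (ENNReal.ofReal ((2 * Real.pi * (4 * (A * R - R) / 9) ^ 3)⁻¹) * ENNReal.ofReal (2 * (2 * (A * R)) * M) +
            Fb * ENNReal.ofReal (2 * (A * R) * M)) *
          volume {z : EuclideanSpace ℝ (Fin 3) | R < ‖z‖ ∧ ‖z‖ < A * R} := ⟨_, rfl⟩
  have hB₀ : B₀ ≠ ⊤ := by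
    rw [hB₀def]
    refine ENNReal.add_ne_top.2 ⟨ENNReal.mul_ne_top (ENNReal.mul_ne_top hCb (ENNReal.pow_ne_top ENNReal.ofReal_ne_top)) hvolT,
      ENNReal.mul_ne_top (ENNReal.add_ne_top.2 ⟨ENNReal.mul_ne_top ENNReal.ofReal_ne_top ENNReal.ofReal_ne_top,
        ENNReal.mul_ne_top hFb ENNReal.ofReal_ne_top⟩) hvolT⟩
  -- ### the budget of every window pressure at every late time
  have hPq : ∃ mP δP : ℝ, 0 < δP ∧ ∀ t ∈ Ioo (-δP) 0,
      ∀ (a c : ℝ) (q : ℝ → EuclideanSpace ℝ (Fin 3) → ℝ), t ∈ Ioo a c →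
        IsClassicalNSSolutionOn (Ioo a c) 1 0 V q →
        ∃ cst : ℝ, ∫ y in {y : EuclideanSpace ℝ (Fin 3) |
          (5 * R + 4 * (A * R)) / 9 ≤ ‖y‖ ∧ ‖y‖ ≤ (4 * R + 5 * (A * R)) / 9}, |q t y - cst| ≤ mP := by
    refine ⟨B₀.toReal, min δ ((A * R) ^ 2), lt_min hδ (by positivity), fun t ht a c q htac hcl => ?_⟩
    have htδ : -δ < t := lt_of_le_of_lt (neg_le_neg (min_le_left _ _)) ht.1
    have htr : -(A * R) ^ 2 < t := lt_of_le_of_lt (neg_le_neg (min_le_right _ _)) ht.1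
    have ht0 : t < 0 := ht.2
    -- the time window `[t − η, t + η] ⊆ ]a, c[ ∩ ]−∞, 0[`
    obtain ⟨η, hηdef⟩ : ∃ η : ℝ, η = min (min (t - a) (c - t)) (-t) / 2 := ⟨_, rfl⟩
    have hη : 0 < η := by
      rw [hηdef]; exact half_pos (lt_min (lt_min (by linarith [htac.1]) (by linarith [htac.2])) (by linarith))
    have hη1 : η ≤ (t - a) / 2 := by
      rw [hηdef]; linarith [min_le_left (min (t - a) (c - t)) (-t), min_le_left (t - a) (c - t)]
    have hη2 : η ≤ (c - t) / 2 := by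
      rw [hηdef]; linarith [min_le_left (min (t - a) (c - t)) (-t), min_le_right (t - a) (c - t)]
    have hη3 : η ≤ -t / 2 := by rw [hηdef]; linarith [min_le_right (min (t - a) (c - t)) (-t)]
    have hIcc : Icc (t - η) (t + η) ⊆ Ioo a c := fun s hs => ⟨by linarith [hs.1], by linarith [hs.2]⟩
    have htop' : t + η < 0 := by linarith
    -- the sup bound `M' = C/√(−(t+η))` on the window (rate)
    have hsq : 0 < Real.sqrt (-(t + η)) := Real.sqrt_pos.2 (by linarith)
    have hM'0 : 0 ≤ C / Real.sqrt (-(t + η)) := div_nonneg hC0 hsq.le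
    have hM' : ∀ σ ∈ Icc (t - η) (t + η), ∀ y, ‖V σ y‖ ≤ C / Real.sqrt (-(t + η)) := by
      intro σ hσ y
      have hσ0 : σ < 0 := by linarith [hσ.2]
      refine (hdec σ hσ0 y).trans (div_le_div_of_nonneg_left hC0 hsq ?_)
      exact Real.sqrt_le_sqrt (by linarith [hσ.2])
    -- the Oseen-mild clause on the window
    have hmild' : ∀ s t' : ℝ, s ∈ Icc (t - η) (t + η) → t' ∈ Icc (t - η) (t + η) → s < t' → ∀ x,
        V t' x = heatExtension (V s) (t' - s) x - oseenDuhamel 1 s V V t' x :=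
      fun s t' _ ht' hst' x => hmild s t' hst' (by linarith [ht'.2]) x
    -- the A-Morrey bound at time `t` and the quiet bound
    have hα : ∀ z : EuclideanSpace ℝ (Fin 3), ∫⁻ y in ball z (A * R), ‖V t y‖ₑ ^ 2 ≤
        ENNReal.ofReal (2 * (A * R) * M) := fun z => lintegral_ball_repr_sq_le hI hUVs hsm hr z ⟨htr, ht0⟩
    have hKb : ∀ y : EuclideanSpace ℝ (Fin 3), R < ‖y‖ → ‖y‖ < A * R → ‖V t y‖ ≤ K :=
      norm_repr_le_of_quietShell hq hUV hVc t ⟨htδ, ht0⟩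
    -- the budget
    obtain ⟨κ, hκ⟩ := hbud isOpen_Ioo hcl hη hIcc hM'0 hM' hmild' hα (by linarith) hKb
    have hθ : 0 < 4 * (A * R - R) / 9 := by linarith
    have hle := hκ (4 * (A * R - R) / 9) ((5 * R + 4 * (A * R)) / 9) ((4 * R + 5 * (A * R)) / 9) hθ
      (by linarith) (by linarith) (by linarith)
    -- the `2r`-ball term at time `t`
    have h2ball : ∫⁻ z in ball (0 : EuclideanSpace ℝ (Fin 3)) (2 * (A * R)), ‖V t z‖ₑ ^ 2 ≤
        ENNReal.ofReal (2 * (2 * (A * R)) * M) :=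
      lintegral_ball_repr_sq_le hI hUVs hsm h2r 0 ⟨by nlinarith, ht0⟩
    have hleB : ∫⁻ y in {y : EuclideanSpace ℝ (Fin 3) | (5 * R + 4 * (A * R)) / 9 < ‖y‖ ∧
        ‖y‖ < (4 * R + 5 * (A * R)) / 9}, ‖q t y - κ‖ₑ ≤ B₀ := by
      refine hle.trans ?_
      rw [hB₀def]
      gcongr
    refine ⟨κ, ?_⟩
    have hqm : AEStronglyMeasurable (fun y => q t y - κ) (volume : Measure (EuclideanSpace ℝ (Fin 3))) :=
      ((hcl.contDiff_pressure htac).continuous.sub continuous_const).aestronglyMeasurable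
    exact integral_closedAnnulus_le_of_lintegral_annulus_le hqm hB₀ hleB
  -- ### the manufactured continuous local rate `β_loc(s) = sup_{|y| ≤ AR} ‖V(s, y)‖`
  have hKc : IsCompact (closedBall (0 : EuclideanSpace ℝ (Fin 3)) (A * R)) := isCompact_closedBall _ _
  obtain ⟨βl, hβldef⟩ : ∃ βl : ℝ → ℝ, βl = fun s =>
      sSup ((fun y => ‖V s y‖) '' closedBall (0 : EuclideanSpace ℝ (Fin 3)) (A * R)) := ⟨_, rfl⟩
  have hbdd : ∀ s : ℝ, s < 0 →
      BddAbove ((fun y => ‖V s y‖) '' closedBall (0 : EuclideanSpace ℝ (Fin 3)) (A * R)) := fun s hs =>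
    (hKc.image_of_continuousOn (hsm.contDiff_slice hs).continuous.norm.continuousOn).bddAbove
  have hβl_ge : ∀ s : ℝ, s < 0 → ∀ y : EuclideanSpace ℝ (Fin 3), ‖y‖ ≤ A * R → ‖V s y‖ ≤ βl s := by
    intro s hs y hy
    rw [hβldef]
    exact le_csSup (hbdd s hs) (mem_image_of_mem _ (mem_closedBall_zero_iff.2 hy))
  have hβl_le : ∀ s : ℝ, s < 0 → ∀ c : ℝ,
      (∀ y ∈ closedBall (0 : EuclideanSpace ℝ (Fin 3)) (A * R), ‖V s y‖ ≤ c) → βl s ≤ c := by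
    intro s _ c hc
    rw [hβldef]
    exact csSup_le ⟨‖V s 0‖, 0, mem_closedBall_self hr.le, rfl⟩ (forall_mem_image.2 hc)
  have hβl0 : ∀ s : ℝ, s < 0 → 0 ≤ βl s := fun s hs =>
    (norm_nonneg (V s 0)).trans (hβl_ge s hs 0 (by rw [norm_zero]; positivity))
  -- continuity on `]−∞, 0[`
  have hβlc : ContinuousOn βl (Iio 0) := by
    rw [continuousOn_iff_continuous_restrict]
    have hg : Continuous fun w : Iio (0 : ℝ) × EuclideanSpace ℝ (Fin 3) =>
        ((w.1 : ℝ), w.2) := (continuous_subtype_val.comp continuous_fst).prodMk continuous_snd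
    have hf : Continuous (↿(fun (s : Iio (0 : ℝ)) (y : EuclideanSpace ℝ (Fin 3)) => ‖V s y‖)) := by
      have h1 : Continuous fun w : Iio (0 : ℝ) × EuclideanSpace ℝ (Fin 3) => uncurry V ((w.1 : ℝ), w.2) :=
        hVc.comp_continuous hg fun w => ⟨w.1.2, mem_univ _⟩
      exact h1.norm
    have h := hKc.continuous_sSup hf
    rw [hβldef]
    exact h
  have hβlcT : ContinuousOn βl (Ioo T 0) := hβlc.mono fun s hs => hs.2
  -- ### `β_loc ≤ β` for a.e. `s ∈ ]T, 0[`
  have hcmp : ∀ᵐ s ∂(volume.restrict (Ioo T 0)), βl s ≤ β s := by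
    have hslab : Ioo T 0 ×ˢ (univ : Set (EuclideanSpace ℝ (Fin 3))) ⊆ Iio (0 : ℝ) ×ˢ univ :=
      prod_mono (fun t ht => ht.2) subset_rfl
    have h1 : ∀ᵐ z ∂(volume.restrict (Ioo T 0 ×ˢ (univ : Set (EuclideanSpace ℝ (Fin 3))))),
        ‖V z.1 z.2‖ ≤ β z.1 := by
      filter_upwards [hβU, ae_restrict_of_ae_restrict_of_subset hslab hUV] with z hz hz2
      have e : U z.1 z.2 = V z.1 z.2 := hz2
      rw [← e]; exact hz
    have h2 : ∀ᵐ s ∂(volume.restrict (Ioo T 0)), ∀ᵐ y : EuclideanSpace ℝ (Fin 3), ‖V s y‖ ≤ β s := by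
      have h3 : ∀ᵐ z ∂((volume.restrict (Ioo T 0)).prod (volume : Measure (EuclideanSpace ℝ (Fin 3)))),
          ‖V z.1 z.2‖ ≤ β z.1 := by
        rw [← Measure.restrict_univ (μ := (volume : Measure (EuclideanSpace ℝ (Fin 3)))),
          Measure.prod_restrict, ← Measure.volume_eq_prod]
        exact h1
      exact Measure.ae_ae_of_ae_prod h3
    filter_upwards [h2, ae_restrict_mem measurableSet_Ioo] with s hs hsT
    exact hβl_le s hsT.2 (β s) fun y _ =>
      forall_le_of_ae_le_of_continuous (hsm.contDiff_slice hsT.2).continuous.norm hs y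
  -- ### the primitive `P(s) = ∫_{T/2}^{s} β_loc²/2` and the log-mean hypothesis for it
  have hT2 : T / 2 ∈ Ioo T 0 := ⟨by linarith, by linarith⟩
  have hcont2 : ContinuousOn (fun σ => βl σ ^ 2 / 2) (Ioo T 0) := (hβlcT.pow 2).div_const 2
  have hII : ∀ a ∈ Ioo T 0, ∀ b ∈ Ioo T 0, IntervalIntegrable (fun σ => βl σ ^ 2 / 2) volume a b := by
    intro a ha b hb
    refine (hcont2.mono fun σ hσ => ?_).intervalIntegrable
    exact ⟨lt_of_lt_of_le (lt_min ha.1 hb.1) hσ.1, lt_of_le_of_lt hσ.2 (max_lt ha.2 hb.2)⟩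
  obtain ⟨Pβ, hPβdef⟩ : ∃ Pβ : ℝ → ℝ, Pβ = fun s => ∫ σ in (T / 2)..s, βl σ ^ 2 / 2 := ⟨_, rfl⟩
  have hP : ∀ s ∈ Ioo T 0, HasDerivAt Pβ ((-s) * (βl s ^ 2 / 2) / (-s)) s := by
    intro s hs
    have hne : (-s) ≠ 0 := by linarith [hs.2]
    rw [mul_div_cancel_left₀ _ hne, hPβdef]
    exact intervalIntegral.integral_hasDerivAt_right (hII _ hT2 _ hs)
      (hcont2.stronglyMeasurableAtFilter isOpen_Ioo s hs) (hcont2.continuousAt (isOpen_Ioo.mem_nhds hs))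
  have hLMP : ∀ s' ∈ Ioo T 0, ∀ s ∈ Ioo T 0, s' ≤ s →
      Pβ s - Pβ s' ≤ q' * Real.log ((-s') / (-s)) + K₀ := by
    intro s' hs' s hs h
    have hsub : Pβ s - Pβ s' = ∫ σ in s'..s, βl σ ^ 2 / 2 := by
      rw [hPβdef]
      exact intervalIntegral.integral_interval_sub_left (hII _ hT2 _ hs) (hII _ hT2 _ hs')
    rw [hsub, intervalIntegral.integral_of_le h, integral_div]
    -- the Bochner integral over `]s', s]` as a lintegral over `]s', s[`
    have hIoc : Ioc s' s ⊆ Ioo T 0 :=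
      fun σ hσ => ⟨lt_of_lt_of_le hs'.1 (le_of_lt hσ.1), lt_of_le_of_lt hσ.2 hs.2⟩
    have hmeas : AEStronglyMeasurable (fun σ => βl σ ^ 2) (volume.restrict (Ioc s' s)) :=
      ((hβlcT.pow 2).mono hIoc).aestronglyMeasurable measurableSet_Ioc
    have hnn : 0 ≤ᵐ[volume.restrict (Ioc s' s)] fun σ => βl σ ^ 2 :=
      Eventually.of_forall fun σ => sq_nonneg _
    rw [integral_eq_lintegral_of_nonneg_ae hnn hmeas, Measure.restrict_congr_set Ioo_ae_eq_Ioc.symm]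
    have hlog : 0 ≤ Real.log ((-s') / (-s)) :=
      Real.log_nonneg ((one_le_div (by linarith [hs.2])).2 (by linarith))
    have hr : 0 ≤ 2 * q' * Real.log ((-s') / (-s)) + K₀ := by positivity
    have hIoo : Ioo s' s ⊆ Ioo T 0 := fun σ hσ => ⟨hs'.1.trans hσ.1, hσ.2.trans hs.2⟩
    have hle : ∫⁻ σ in Ioo s' s, ENNReal.ofReal (βl σ ^ 2) ≤
        ENNReal.ofReal (2 * q' * Real.log ((-s') / (-s)) + K₀) := by
      refine (lintegral_mono_ae ?_).trans (hLM' s' hs' s hs h)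
      filter_upwards [ae_restrict_of_ae_restrict_of_subset hIoo hcmp,
        ae_restrict_mem measurableSet_Ioo] with σ hσ hσI
      have h0 : 0 ≤ βl σ := hβl0 σ (hσI.2.trans hs.2)
      exact ENNReal.ofReal_le_ofReal (by nlinarith [mul_le_mul hσ hσ h0 (h0.trans hσ)])
    have hfin := ENNReal.toReal_le_of_le_ofReal hr hle
    linarith
  -- ### the engine with the local rate
  exact one_le_logMean_of_quietShell_of_reprBudget_ball hsw hG hI hD htop hsing hA hR hδ hq hUV hVc hsm
    (fun s hs y => hdec s hs y) hwin hPq hT hK₀ (p := fun s => (-s) * (βl s ^ 2 / 2))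
    (fun s hs y hy => hβl_ge s hs.2 y hy.le)
    (fun s hs => le_of_eq (by
      have hne : (-s) ≠ 0 := by linarith [hs.2]
      show βl s ^ 2 = 2 * ((-s) * (βl s ^ 2 / 2)) / (-s)
      rw [show 2 * ((-s) * (βl s ^ 2 / 2)) = βl s ^ 2 * (-s) by ring, mul_div_cancel_right₀ _ hne]))
    (fun s hs => mul_nonneg (by linarith [hs.2]) (by positivity)) hP hLMP

end Summit.NavierStokesRegularity.NavierStokesRegularity.Theorems.TypeITraceScarL3

end
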